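import Mathlib
import HarnessLib

/-!
# ValiantsHypothesis / LacunarySymmetroid — crux `MatrixDescartes` (stmt-ValiantsHypothesis-18050, V1),
# LINE (A) «product_plus_one» (`Cruxes/MatrixDescartes/Lines/product_plus_one.lean` @a0cf3f5276f3):
# ROLLE FOR THE EULER OPERATOR and the COUPLING-FREE REDUCTION of the class count (S4 made quantitative)

The class member is `h = ∏_{j<m} f_j + c·X^(m·d l₀)`, `f_j = Σ_l a_{jl} X^(d l)` on a common support (line file,
`prodPlusMonomial`).  The line's S4 (`LogDerivIdentity`) says the count is governed by the logarithmic derivative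
`Σ_j f_j′/f_j`.  This file makes that QUANTITATIVE and removes the coupling constant `c`:

* `exists_root_euler_between`, `card_pos_roots_le_euler` — ROLLE for `θ_N := X·d/dX − N` on `(0,∞)`: between two
  positive zeros of `h` lies a zero of `X h′ − N h` (Rolle for `h(u)/u^N`), so `Z₊(h) ≤ Z₊(X h′ − N h) + 1` whenever
  `X h′ − N h ≠ 0` (`Z₊` = number of DISTINCT positive zeros, the line's `roots.toFinset.filter (0 < ·)` currency);
* `euler_sub_monomial` — `θ_N` KILLS the coupling monomial: `θ_N (g − c X^N) = θ_N g`;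
* `card_pos_roots_sub_monomial_le_euler` — hence, for EVERY real polynomial `g`, EVERY `c` and EVERY `N`,
  `Z₊(g − c X^N) ≤ Z₊(X g′ − N g) + 1` (unconditionally: if `X g′ = N g` then `g − c X^N` is a monomial);
* `euler_prod` — Leibniz with weights: `X (∏ f_j)′ − (m w) ∏ f_j = Σ_j (X f_j′ − w f_j) ∏_{i≠j} f_i`;
* `euler_fewnomial` — on a fewnomial, `X f′ − (d l₀) f = Σ_l a_l (d l − d l₀) X^(d l)`: the letter `l₀` DROPS OUT;
* `card_pos_roots_class_le_euler` — THE REDUCTION for the class (line shape `C c * X ^ (m * d l₀) + ∏ j, fewnomial d (a j)`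
  unfolded verbatim): `Z₊(member) ≤ 1 + Z₊(Σ_j B_j · ∏_{i≠j} f_i)` with `B_j = Σ_l a_{jl} (d l − d l₀) X^(d l)` the
  `(K−1)`-nomials of the letters OTHER than the coupled one — a `c`-free polynomial of the same sparse product type
  (every approach to the research stubs `stub_classRowK3` / `stub_polyLaw` — Khovanskii–Rolle, Wronskians, convexity —
  starts from this count; the Rolle floor `m(K−1)` of the card is the case where every `B_j ∏_{i≠j} f_i`-zero is real).

HONEST FRAMING: Rolle bookkeeping for LINE (A); NOT `stub_classRowK3`, not `stub_polyLaw` / `PPOPolyLaw`, not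
`ProductPlusOneMDR`, not `MatrixDescartes`, not Conjecture B; `VP ≠ VNP` is NOT proved.  No definitions, no named facts;
Mathlib only.
-/

-- `Summit.ValiantsHypothesis.ValiantsHypothesis.…` is the tree's mandated single-conjunct layout (Sub = Summit).
set_option linter.dupNamespace false

namespace Summit.ValiantsHypothesis.ValiantsHypothesis.Theorems.LacunarySymmetroidMatrixDescartes

namespace ProductPlusOne

open Polynomial Finset
open scoped BigOperators

/-! ### Rolle for the Euler operator `θ_N = X·d/dX − N` on `(0, ∞)` -/

/-- Between two positive zeros `x < y` of a real polynomial `h` there is a zero of `X·h′ − N·h`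
(Rolle's theorem for `u ↦ h(u)/u^N` on `[x, y]`). [folklore] -/
theorem exists_root_euler_between (h : ℝ[X]) (N : ℕ) {x y : ℝ} (hx : 0 < x) (hxy : x < y)
    (hx0 : h.eval x = 0) (hy0 : h.eval y = 0) :
    ∃ z ∈ Set.Ioo x y, (X * derivative h - C (N : ℝ) * h).eval z = 0 := by
  have hcont : ContinuousOn (fun u : ℝ => h.eval u / u ^ N) (Set.Icc x y) := by
    refine ContinuousOn.div h.continuousOn (continuousOn_pow N) ?_
    intro u hu
    exact pow_ne_zero _ (lt_of_lt_of_le hx hu.1).ne'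
  have hends : (fun u : ℝ => h.eval u / u ^ N) x = (fun u : ℝ => h.eval u / u ^ N) y := by
    simp only [hx0, hy0, zero_div]
  obtain ⟨z, hz, hz'⟩ := exists_deriv_eq_zero hxy hcont hends
  have hz0 : 0 < z := hx.trans hz.1
  have hd : HasDerivAt (fun u : ℝ => h.eval u / u ^ N)
      ((h.derivative.eval z * z ^ N - h.eval z * ((N : ℝ) * z ^ (N - 1))) / (z ^ N) ^ 2) z :=
    (h.hasDerivAt z).div (hasDerivAt_pow N z) (pow_ne_zero _ hz0.ne')
  have hnum : h.derivative.eval z * z ^ N - h.eval z * ((N : ℝ) * z ^ (N - 1)) = 0 := by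
    have h1 := hd.deriv
    rw [hz'] at h1
    rcases div_eq_zero_iff.mp h1.symm with h2 | h2
    · exact h2
    · exact absurd h2 (pow_ne_zero _ (pow_ne_zero _ hz0.ne'))
  refine ⟨z, hz, ?_⟩
  rw [eval_sub, eval_mul, eval_X, eval_mul, eval_C]
  cases N with
  | zero =>
    simp only [pow_zero, mul_one, Nat.cast_zero, zero_mul, mul_zero, sub_zero] at hnum ⊢
    rw [hnum, mul_zero]
  | succ n =>
    rw [Nat.add_sub_cancel] at hnum
    have key : z ^ n * (z * h.derivative.eval z - ((n + 1 : ℕ) : ℝ) * h.eval z) = 0 := by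
      have e : z ^ n * (z * h.derivative.eval z - ((n + 1 : ℕ) : ℝ) * h.eval z)
          = h.derivative.eval z * z ^ (n + 1) - h.eval z * (((n + 1 : ℕ) : ℝ) * z ^ n) := by ring
      rw [e]
      exact hnum
    exact (mul_eq_zero.mp key).resolve_left (pow_ne_zero _ hz0.ne')

/-- **Rolle for `θ_N` (distinct positive zeros):** `Z₊(h) ≤ Z₊(X·h′ − N·h) + 1` whenever `X·h′ − N·h ≠ 0`. [folklore] -/
theorem card_pos_roots_le_euler (h : ℝ[X]) (N : ℕ) (hE : X * derivative h - C (N : ℝ) * h ≠ 0) :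
    (h.roots.toFinset.filter (fun t => 0 < t)).card ≤
      ((X * derivative h - C (N : ℝ) * h).roots.toFinset.filter (fun t => 0 < t)).card + 1 := by
  have hh : h ≠ 0 := by
    rintro rfl
    exact hE (by rw [derivative_zero, mul_zero, mul_zero, sub_zero])
  refine (Finset.card_le_sdiff_of_interleaved ?_).trans
    (Nat.add_le_add_right (Finset.card_le_card Finset.sdiff_subset) 1)
  intro x hx y hy hxy _
  rw [Finset.mem_filter, Multiset.mem_toFinset, mem_roots hh, IsRoot.def] at hx hy
  obtain ⟨z, hz, hz0⟩ := exists_root_euler_between h N hx.2 hxy hx.1 hy.1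
  refine ⟨z, ?_, hz.1, hz.2⟩
  rw [Finset.mem_filter, Multiset.mem_toFinset, mem_roots hE, IsRoot.def]
  exact ⟨hz0, hx.2.trans hz.1⟩

/-! ### The Euler operator on coefficients; the coupling monomial dies -/

/-- Coefficients of `X·h′ − N·h`: `[X^i](X h′ − N h) = (i − N)·[X^i] h`. [folklore] -/
theorem coeff_euler (h : ℝ[X]) (N i : ℕ) :
    (X * derivative h - C (N : ℝ) * h).coeff i = ((i : ℝ) - N) * h.coeff i := by
  rw [coeff_sub, coeff_C_mul]
  cases i with
  | zero =>
    rw [coeff_X_mul_zero]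
    push_cast
    ring
  | succ n =>
    rw [coeff_X_mul, coeff_derivative]
    push_cast
    ring

/-- `θ_N` kills the monomial of degree `N`: `X·(c X^N)′ − N·(c X^N) = 0`. [folklore] -/
theorem euler_C_mul_X_pow (c : ℝ) (N : ℕ) :
    X * derivative (C c * X ^ N) - C (N : ℝ) * (C c * X ^ N) = 0 := by
  ext i
  rw [coeff_euler, coeff_zero, coeff_C_mul_X_pow]
  split_ifs with hi
  · rw [hi, sub_self, zero_mul]
  · rw [mul_zero]

/-- **The coupling constant drops out:** `θ_N (g − c X^N) = θ_N g`. [folklore] -/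
theorem euler_sub_monomial (g : ℝ[X]) (c : ℝ) (N : ℕ) :
    X * derivative (g - C c * X ^ N) - C (N : ℝ) * (g - C c * X ^ N) = X * derivative g - C (N : ℝ) * g := by
  have h := euler_C_mul_X_pow c N
  rw [derivative_sub]
  linear_combination -h

/-- If `X·g′ = N·g` then `g` is the monomial `[X^N]g · X^N`. [folklore] -/
theorem eq_monomial_of_euler_eq_zero (g : ℝ[X]) (N : ℕ) (hE : X * derivative g - C (N : ℝ) * g = 0) :
    g = C (g.coeff N) * X ^ N := by
  ext i
  rw [coeff_C_mul_X_pow]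
  split_ifs with hi
  · rw [hi]
  · have h1 := congrArg (fun p : ℝ[X] => p.coeff i) hE
    simp only [coeff_euler, coeff_zero] at h1
    rcases mul_eq_zero.mp h1 with h2 | h2
    · exact absurd h2 (sub_ne_zero.mpr (by exact_mod_cast hi))
    · exact h2

/-- A monomial has no positive zero. [folklore] -/
theorem card_pos_roots_C_mul_X_pow (a : ℝ) (N : ℕ) :
    ((C a * X ^ N : ℝ[X]).roots.toFinset.filter (fun t => 0 < t)).card = 0 := by
  rw [Finset.card_eq_zero, Finset.filter_eq_empty_iff]
  intro t ht
  rw [Multiset.mem_toFinset] at ht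
  by_cases ha : a = 0
  · rw [ha, map_zero, zero_mul, roots_zero] at ht
    exact absurd ht (Multiset.notMem_zero _)
  · rw [roots_C_mul_X_pow ha] at ht
    have h0 : t = 0 := Multiset.mem_singleton.mp (Multiset.mem_of_mem_nsmul ht)
    rw [h0]
    exact lt_irrefl 0

/-- **`Z₊(g − c·X^N) ≤ Z₊(X·g′ − N·g) + 1` for EVERY real polynomial `g`, EVERY real `c`, EVERY `N`**
(Rolle for `θ_N` after the coupling monomial has dropped out; if `X g′ = N g` the left side is `0`). [folklore] -/
theorem card_pos_roots_sub_monomial_le_euler (g : ℝ[X]) (c : ℝ) (N : ℕ) :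
    ((g - C c * X ^ N).roots.toFinset.filter (fun t => 0 < t)).card ≤
      ((X * derivative g - C (N : ℝ) * g).roots.toFinset.filter (fun t => 0 < t)).card + 1 := by
  by_cases hE : X * derivative g - C (N : ℝ) * g = 0
  · have hmono : g - C c * X ^ N = C (g.coeff N - c) * X ^ N := by
      conv_lhs => rw [eq_monomial_of_euler_eq_zero g N hE]
      rw [map_sub, sub_mul]
    rw [hmono, card_pos_roots_C_mul_X_pow]
    exact Nat.zero_le _
  · have hE' : X * derivative (g - C c * X ^ N) - C (N : ℝ) * (g - C c * X ^ N) ≠ 0 := by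
      rwa [euler_sub_monomial]
    have h1 := card_pos_roots_le_euler (g - C c * X ^ N) N hE'
    rwa [euler_sub_monomial] at h1

/-- The `+` form of the previous bound (line shape `C c * X ^ N + g`). [folklore] -/
theorem card_pos_roots_monomial_add_le_euler (g : ℝ[X]) (c : ℝ) (N : ℕ) :
    ((C c * X ^ N + g).roots.toFinset.filter (fun t => 0 < t)).card ≤
      ((X * derivative g - C (N : ℝ) * g).roots.toFinset.filter (fun t => 0 < t)).card + 1 := by
  have h1 := card_pos_roots_sub_monomial_le_euler g (-c) N
  have e : g - C (-c) * X ^ N = C c * X ^ N + g := by rw [map_neg]; ring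
  rwa [e] at h1

/-! ### Leibniz with weights; the coupled letter drops out of each factor -/

/-- **Leibniz with weights:** `X·(∏_j f_j)′ − (m·w)·∏_j f_j = Σ_j (X f_j′ − w f_j) · ∏_{i ≠ j} f_i`. [folklore] -/
theorem euler_prod {m : ℕ} (f : Fin m → ℝ[X]) (w : ℝ) :
    X * derivative (∏ j, f j) - C ((m : ℝ) * w) * ∏ j, f j
      = ∑ j, (X * derivative (f j) - C w * f j) * ∏ i ∈ Finset.univ.erase j, f i := by
  have hsplit : C ((m : ℝ) * w) * ∏ j, f j = ∑ j : Fin m, C w * f j * ∏ i ∈ Finset.univ.erase j, f i := by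
    have h1 : ∀ j : Fin m, C w * f j * ∏ i ∈ Finset.univ.erase j, f i = C w * ∏ i, f i := by
      intro j
      rw [mul_assoc, Finset.mul_prod_erase _ _ (Finset.mem_univ j)]
    simp_rw [h1]
    rw [Finset.sum_const, Finset.card_univ, Fintype.card_fin, nsmul_eq_mul, map_mul, map_natCast, mul_assoc]
  rw [derivative_prod_finset, Finset.mul_sum, hsplit, ← Finset.sum_sub_distrib]
  refine Finset.sum_congr rfl (fun j _ => ?_)
  ring

/-- **The coupled letter drops out:** for a fewnomial `f = Σ_l a_l X^(d l)`,
`X·f′ − (d l₀)·f = Σ_l a_l (d l − d l₀) X^(d l)` — a `(K−1)`-nomial (the `l₀` term vanishes). [folklore] -/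
theorem euler_fewnomial {K : ℕ} (d : Fin K → ℕ) (b : Fin K → ℝ) (l₀ : Fin K) :
    X * derivative (∑ l, C (b l) * X ^ (d l)) - C ((d l₀ : ℕ) : ℝ) * ∑ l, C (b l) * X ^ (d l)
      = ∑ l, C (b l * ((d l : ℝ) - d l₀)) * X ^ (d l) := by
  ext i
  rw [coeff_euler, finsetSum_coeff, finsetSum_coeff, Finset.mul_sum]
  refine Finset.sum_congr rfl (fun l _ => ?_)
  rw [coeff_C_mul_X_pow, coeff_C_mul_X_pow]
  split_ifs with h
  · rw [h]
    ring
  · rw [mul_zero]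

/-- **THE COUPLING-FREE REDUCTION (class shape of the line, `prodPlusMonomial` unfolded verbatim):**
`Z₊(c·X^(m·d l₀) + ∏_j f_j) ≤ 1 + Z₊(Σ_j B_j · ∏_{i≠j} f_i)`, `B_j = Σ_l a_{jl} (d l − d l₀) X^(d l)`, for every `m`, `K`,
`d`, `a`, `l₀`, `c`.  [this file's theorem; Rolle for `θ_{m·d l₀}` + Leibniz] -/
theorem card_pos_roots_class_le_euler {m K : ℕ} (d : Fin K → ℕ) (a : Fin m → Fin K → ℝ) (l₀ : Fin K) (c : ℝ) :
    ((C c * X ^ (m * d l₀) + ∏ j, ∑ l, C (a j l) * X ^ (d l) : ℝ[X]).roots.toFinset.filter (fun t => 0 < t)).card ≤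
      ((∑ j, (∑ l, C (a j l * ((d l : ℝ) - d l₀)) * X ^ (d l)) * ∏ i ∈ Finset.univ.erase j, ∑ l, C (a i l) * X ^ (d l)
          : ℝ[X]).roots.toFinset.filter (fun t => 0 < t)).card + 1 := by
  have h1 := card_pos_roots_monomial_add_le_euler (∏ j, ∑ l, C (a j l) * X ^ (d l) : ℝ[X]) c (m * d l₀)
  have e : X * derivative (∏ j, ∑ l, C (a j l) * X ^ (d l) : ℝ[X])
        - C ((m * d l₀ : ℕ) : ℝ) * ∏ j, ∑ l, C (a j l) * X ^ (d l)
      = ∑ j, (∑ l, C (a j l * ((d l : ℝ) - d l₀)) * X ^ (d l)) * ∏ i ∈ Finset.univ.erase j, ∑ l, C (a i l) * X ^ (d l) := by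
    rw [Nat.cast_mul, euler_prod]
    refine Finset.sum_congr rfl (fun j _ => ?_)
    rw [euler_fewnomial]
  rwa [e] at h1

end ProductPlusOne

end Summit.ValiantsHypothesis.ValiantsHypothesis.Theorems.LacunarySymmetroidMatrixDescartes
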